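import Literature.Geometry.Kaehler.ComplexTorusTranscendentalLatticeAllDegrees
import Literature.Geometry.Kaehler.ComplexTorusIntegralHodgeClassesProduct
import Literature.Geometry.Kaehler.ComplexTorusHodgeClassesMaximalPicardNumber
import HarnessLib

/-!
# The transcendental lattice in every degree: odd and extreme degrees, the lower bound `rk T ≥ b_l − h^{p,p}` (so `T ≠ 0` in every
# intermediate even degree), and the exact rank `C(2g, l) − C(g, p)²` at maximal Picard number (`rk T(E_τ × E_τ) = 2` for CM `E_τ`)

Layer `Literature/Geometry/Kaehler`, namespace `Literature.Geometry.Kaehler.ComplexTorus`; lane `lit-hodgefound` (Track 2 foundations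
library), seat p09, generation 31, row g31-#13. THEOREMS ONLY (0 definitions); no named fact, net debt 0. Continues g31-#11
(`ComplexTorusTranscendentalLatticeAllDegrees`): for a complex torus `X = E/Φ(ℤ^ι)`, `|ι| = 2g`, an enumeration `e : Fin n ≃ ι`,
`h : k + l = n`, and the degree-`l` transcendental lattice (written out exactly as there, no definition)

  `T = Hˡ(X, ℤ) ∩ ⋂_{s ∈ Hdg^{k,p}(X, ℤ)} ker ⟨s, ·⟩`,   `rk_ℤ T = C(|ι|, l) − rk_ℤ Hdg^{k,p}(X, ℤ)` (g31-#11):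

* §1 beyond the top degree there are no classes (`Hᵏ = 0` for `k > 2g`): `hodgeClassesIn_eq_bot_of_card_lt`, `integralHodgeClassesIn_eq_bot_of_card_lt`.
* §2 `k ≠ 2p` (e.g. `k` odd): `Hdg^{k,p} = 0` (the tree's `integralHodgeClassesIn_eq_bot_of_ne`), so **`T = Hˡ(X, ℤ)`**, `rk T = C(|ι|, l)`.
* §3 the extreme degrees: **`T = 0` for `l = 0`** (`Hdgᵍ(X, ℤ) = H^{2g}(X, ℤ)`, the tree's `integralHodgeClasses_eq_integralForms_of_finrank_eq`,
  pairs perfectly with `H⁰`) and **for `k = 0`** (`Hdg⁰(X, ℤ) = ℤ · 1`, g31-#4's `finrank_integralHodgeClasses_zero_eq_one`).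
* §4 **`rk T ≥ C(2g, l) − C(g, p)²`** for `k = 2p` (`dim_ℚ Bᵖ(X) ≤ h^{p,p}(X) = C(g,p)²`, the tree's `finrank_hodgeClasses_le_choose_sq`,
  Lange Thm. 7.2.4), the binomial inequality **`C(g, p)² < C(2g, 2p)` for `0 < p < g`** (Vandermonde: the summand `C(g, p−1) C(g, p+1) =
  h^{p−1,p+1}` is positive), hence **`T ≠ 0` in every intermediate even degree `l = 2g − 2p`, `0 < p < g`, of EVERY complex torus**.
* §5 **maximal Picard number**: if `dim_ℚ Bᵖ(X) = C(g, p)²` then `rk T = C(2g, l) − C(g, p)²`; for the CM powers `E_τⁿ` (`τ` imaginary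
  quadratic; the tree's `finrank_hodgeClasses_ellipticPow_of_quadratic`) `rk T = C(2n, l) − C(n, p)²`, in particular **`rk T(E_τ × E_τ) = 2`**
  in the middle degree (Shioda–Mitani's singular abelian surfaces: `rk T_X = 6 − ρ = 2`).

## References

* [cite: Lange2023AbelianVarietiesComplex, §7.2.2 Thm. 7.2.4 (and the remark after it); §1.1.5 Prop. 1.1.23 (`h^{p,q} = C(g,p) C(g,q)`); §1.1.3 Exercise 1.1.6 (8); §6.2.4 (p. 310); §2.6.3 Exercise (2) (`ρ(E × E) = 4` for CM)]
* [cite: ShiodaMitani1974, §3 (3.19) and §4 (singular abelian surfaces: `ρ = 4`, `rk T_X = 2`)]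
* [cite: Huybrechts2016K3, Ch. 3 §2.2–2.3 (PDF pp. 58–59)]
-/

noncomputable section

open Module Function

namespace Literature.Geometry.Kaehler.ComplexTorus

section BeyondTop

variable {ι : Type*} [Fintype ι] {E : Type*} [NormedAddCommGroup E] [NormedSpace ℂ E] (Φ : (ι → ℝ) ≃L[ℝ] E)

/-! ## §1 Beyond the top degree -/

/-- Beyond the top degree there are no forms at all: `Hᵏ_Hodge(X) = 0` for `k > 2g = |ι|` (`dim_ℂ Λᵏ = C(2g, k) = 0`, the tree's
`finrank_alt_real_complex`). [cite: Lange2023AbelianVarietiesComplex, §1.1.3 Exercise 1.1.6 (8)] -/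
theorem hodgeClassesIn_eq_bot_of_card_lt {k : ℕ} (hk : Fintype.card ι < k) (p : ℕ) : hodgeClassesIn Φ k p = ⊥ := by
  haveI : FiniteDimensional ℝ E := LinearEquiv.finiteDimensional Φ.toLinearEquiv
  haveI : FiniteDimensional ℂ E := Module.Finite.of_restrictScalars_finite ℝ ℂ E
  haveI : FiniteDimensional ℂ (E [⋀^Fin k]→L[ℝ] ℂ) := finiteDimensional_alt_complex Φ k
  have h0 : finrank ℂ (E [⋀^Fin k]→L[ℝ] ℂ) = 0 := by
    rw [Literature.Analysis.Complex.finrank_alt_real_complex E k, ← card_eq_two_mul_finrank Φ, Nat.choose_eq_zero_of_lt hk]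
  haveI : Subsingleton (E [⋀^Fin k]→L[ℝ] ℂ) := Module.finrank_zero_iff.1 h0
  exact (Submodule.eq_bot_iff _).2 fun γ _ ↦ Subsingleton.elim γ 0

/-- Beyond the top degree: `Hdg^{k,p}(X, ℤ) = 0` for `k > 2g = |ι|`. [cite: Lange2023AbelianVarietiesComplex, §1.1.3 Exercise 1.1.6 (8)] -/
theorem integralHodgeClassesIn_eq_bot_of_card_lt {k : ℕ} (hk : Fintype.card ι < k) (p : ℕ) : integralHodgeClassesIn Φ k p = ⊥ :=
  (AddSubgroup.eq_bot_iff_forall _).2 fun _ hγ ↦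
    (Submodule.mem_bot ℚ).1 (hodgeClassesIn_eq_bot_of_card_lt Φ hk p ▸ integralHodgeClassesIn_subset_hodgeClassesIn Φ k p hγ)

end BeyondTop

section Transcendental

variable {ι : Type*} [Fintype ι] [DecidableEq ι] {E : Type*} [NormedAddCommGroup E] [NormedSpace ℂ E]
  (Φ : (ι → ℝ) ≃L[ℝ] E) {n k l : ℕ} (e : Fin n ≃ ι) (h : k + l = n) (p : ℕ)

/-! ## §2 `k ≠ 2p`: all of `Hˡ(X, ℤ)` is transcendental -/

omit [Fintype ι] in
/-- **`T = Hˡ(X, ℤ)` when `k ≠ 2p`**: there are no Hodge classes of type `(p, p)` in degree `k ≠ 2p` (the tree's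
`integralHodgeClassesIn_eq_bot_of_ne`), so nothing is annihilated — in particular all of `Hˡ(X, ℤ)` is transcendental with respect to an
odd complementary degree `k`. [cite: Huybrechts2016K3, Ch. 3 §2.2 (PDF p. 58)] [cite: Lange2023AbelianVarietiesComplex, §7.2.2] -/
theorem integralHodgeAnnihilator_eq_integralForms_of_ne (hk : p + p ≠ k) :
    integralForms Φ l ⊓ ⨅ s : integralHodgeClassesIn Φ k p,
        (LinearMap.ker (poincarePairing Φ e h (s : E [⋀^Fin k]→L[ℝ] ℂ))).toAddSubgroup = integralForms Φ l := by
  refine le_antisymm inf_le_left fun x hx ↦ (mem_integralHodgeAnnihilator_iff Φ e h p).2 ⟨hx, fun s hs ↦ ?_⟩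
  rw [integralHodgeClassesIn_eq_bot_of_ne Φ hk, AddSubgroup.mem_bot] at hs
  rw [hs, map_zero, LinearMap.zero_apply]

/-- **`rk_ℤ T = C(|ι|, l) = b_l(X)` when `k ≠ 2p`.** [cite: Lange2023AbelianVarietiesComplex, §1.1.3 Exercise 1.1.6 (8)] -/
theorem finrank_integralHodgeAnnihilator_of_ne (hk : p + p ≠ k) :
    finrank ℤ ↥(integralForms Φ l ⊓ ⨅ s : integralHodgeClassesIn Φ k p,
        (LinearMap.ker (poincarePairing Φ e h (s : E [⋀^Fin k]→L[ℝ] ℂ))).toAddSubgroup) = (Fintype.card ι).choose l := by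
  rw [integralHodgeAnnihilator_eq_integralForms_of_ne Φ e h p hk]
  exact finrank_integralForms_eq_choose Φ l

/-! ## §3 The extreme degrees `l = 0` and `k = 0` -/

omit [DecidableEq ι] in
/-- A subgroup of the lattice `Hᵐ(X, ℤ)` of rank `0` is trivial (finitely generated and torsion free, hence free of rank `0`).
[cite: Lange2023AbelianVarietiesComplex, §1.1.3 Exercise 1.1.6 (8)] -/
private theorem eq_bot_of_finrank_eq_zero {m : ℕ} (T : AddSubgroup (E [⋀^Fin m]→L[ℝ] ℂ)) (hT : T ≤ integralForms Φ m)
    (h0 : finrank ℤ T = 0) : T = ⊥ := by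
  haveI : Module.Finite ℤ (integralForms Φ m) := finite_integralForms Φ m
  haveI : Module.Free ℤ (integralForms Φ m) := free_integralForms Φ m
  let j := (AddSubgroup.inclusion hT).toIntLinearMap
  have hj : Injective j := AddSubgroup.inclusion_injective hT
  haveI : Module.Finite ℤ T := Module.Finite.of_injective j hj
  haveI : Module.IsTorsionFree ℤ T := hj.moduleIsTorsionFree j (map_smul j)
  haveI : Subsingleton T := (Module.finrank_eq_zero_iff_of_free ℤ T).1 h0
  exact (AddSubgroup.eq_bot_iff_forall _).2 fun x hx ↦ congrArg Subtype.val (Subsingleton.elim (⟨x, hx⟩ : T) 0)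

/-- **`T = 0` in degree `l = 0`** (`k = 2g`, `p = g`): the top-degree Hodge classes are all of `H^{2g}(X, ℤ)` (the tree's
`integralHodgeClasses_eq_integralForms_of_finrank_eq`, rank `1`), which pairs perfectly with `H⁰(X, ℤ)`:
`rk T = C(2g, 0) − rk Hdgᵍ(X, ℤ) = 1 − 1 = 0` (g31-#11's rank formula). [cite: Lange2023AbelianVarietiesComplex, §6.2.4 (p. 310) and §1.1.5 Thm. 1.1.21] [cite: Huybrechts2016K3, Ch. 3 §2.2 (PDF p. 58)] -/
theorem integralHodgeAnnihilator_eq_bot_of_degree_zero {g : ℕ} (e₀ : Fin (2 * g) ≃ ι) (h₀ : 2 * g + 0 = 2 * g) :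
    integralForms Φ 0 ⊓ ⨅ s : integralHodgeClassesIn Φ (2 * g) g,
        (LinearMap.ker (poincarePairing Φ e₀ h₀ (s : E [⋀^Fin (2 * g)]→L[ℝ] ℂ))).toAddSubgroup = ⊥ := by
  haveI : FiniteDimensional ℝ E := LinearEquiv.finiteDimensional Φ.toLinearEquiv
  haveI : FiniteDimensional ℂ E := Module.Finite.of_restrictScalars_finite ℝ ℂ E
  have hg : Fintype.card ι = 2 * g := by rw [← Fintype.card_congr e₀, Fintype.card_fin]
  have hg' : finrank ℂ E = g := by have := card_eq_two_mul_finrank Φ; omega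
  refine eq_bot_of_finrank_eq_zero Φ _ inf_le_left ?_
  have h1 := finrank_integralHodgeAnnihilator_add_finrank_integralHodgeClassesIn Φ e₀ h₀ g
  have h2 : finrank ℤ (integralHodgeClassesIn Φ (2 * g) g) = 1 := by
    rw [finrank_integralHodgeClassesIn_eq_finrank_hodgeClassesIn]
    exact finrank_hodgeClasses_eq_one_of_finrank_eq Φ hg'
  rw [h2, Nat.choose_zero_right] at h1
  omega

/-- **`T = 0` in codegree `k = 0`** (`l = |ι|`, `p = 0`): `Hdg⁰(X, ℤ) = H⁰(X, ℤ) = ℤ · 1` (g31-#4's `finrank_integralHodgeClasses_zero_eq_one`)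
pairs perfectly with the top degree; `rk T = C(|ι|, |ι|) − 1 = 0`. [cite: Lange2023AbelianVarietiesComplex, §6.2.4 (p. 310) and §1.1.3 Exercise 1.1.6 (8)] [cite: Huybrechts2016K3, Ch. 3 §2.2 (PDF p. 58)] -/
theorem integralHodgeAnnihilator_eq_bot_of_codegree_zero (h₀ : 0 + n = n) :
    integralForms Φ n ⊓ ⨅ s : integralHodgeClassesIn Φ 0 0,
        (LinearMap.ker (poincarePairing Φ e h₀ (s : E [⋀^Fin 0]→L[ℝ] ℂ))).toAddSubgroup = ⊥ := by
  have hn : Fintype.card ι = n := by rw [← Fintype.card_congr e, Fintype.card_fin]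
  refine eq_bot_of_finrank_eq_zero Φ _ inf_le_left ?_
  have h1 := finrank_integralHodgeAnnihilator_add_finrank_integralHodgeClassesIn Φ e h₀ 0
  have h2 : finrank ℤ (integralHodgeClassesIn Φ 0 0) = 1 := finrank_integralHodgeClasses_zero_eq_one Φ
  rw [h2, hn, Nat.choose_self] at h1
  omega

/-! ## §4 `rk T ≥ C(2g, l) − C(g, p)²`; `T ≠ 0` in every intermediate even degree -/

/-- **`C(|ι|, l) ≤ rk_ℤ T + C(g, p)²`** for `k = 2p` (`g = dim_ℂ E`): `rk T = C(|ι|, l) − rk Hdgᵖ(X, ℤ)` and `rk Hdgᵖ(X, ℤ) = dim_ℚ Bᵖ(X) ≤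
h^{p,p}(X) = C(g, p)²` (Lange Thm. 7.2.4: `Bᵖ(X) ⊗ ℂ ↪ H^{p,p}(X)`; the tree's `finrank_hodgeClasses_le_choose_sq`).
[cite: Lange2023AbelianVarietiesComplex, §7.2.2 Thm. 7.2.4 and §1.1.5 Prop. 1.1.23] -/
theorem choose_le_finrank_integralHodgeAnnihilator_add_choose_sq (h₂ : 2 * p + l = n) :
    (Fintype.card ι).choose l ≤ finrank ℤ ↥(integralForms Φ l ⊓ ⨅ s : integralHodgeClassesIn Φ (2 * p) p,
        (LinearMap.ker (poincarePairing Φ e h₂ (s : E [⋀^Fin (2 * p)]→L[ℝ] ℂ))).toAddSubgroup) + ((finrank ℂ E).choose p) ^ 2 := by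
  haveI : FiniteDimensional ℝ E := LinearEquiv.finiteDimensional Φ.toLinearEquiv
  haveI : FiniteDimensional ℂ E := Module.Finite.of_restrictScalars_finite ℝ ℂ E
  have h1 := finrank_integralHodgeAnnihilator_add_finrank_integralHodgeClassesIn Φ e h₂ p
  have h3 : finrank ℤ (integralHodgeClassesIn Φ (2 * p) p) ≤ ((finrank ℂ E).choose p) ^ 2 := by
    rw [finrank_integralHodgeClassesIn_eq_finrank_hodgeClassesIn]
    exact finrank_hodgeClasses_le_choose_sq Φ p
  omega

/-- **`T ≠ 0` as soon as `C(g, p)² < C(|ι|, l)`** (`k = 2p`). [cite: Lange2023AbelianVarietiesComplex, §7.2.2 Thm. 7.2.4 and §1.1.5 Prop. 1.1.23] -/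
theorem integralHodgeAnnihilator_ne_bot_of_choose_sq_lt (h₂ : 2 * p + l = n) (hlt : ((finrank ℂ E).choose p) ^ 2 < (Fintype.card ι).choose l) :
    integralForms Φ l ⊓ ⨅ s : integralHodgeClassesIn Φ (2 * p) p,
        (LinearMap.ker (poincarePairing Φ e h₂ (s : E [⋀^Fin (2 * p)]→L[ℝ] ℂ))).toAddSubgroup ≠ ⊥ := by
  intro hbot
  have h1 := choose_le_finrank_integralHodgeAnnihilator_add_choose_sq Φ e p h₂
  rw [hbot] at h1
  have h0 : finrank ℤ ↥(⊥ : AddSubgroup (E [⋀^Fin l]→L[ℝ] ℂ)) = 0 := by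
    haveI : Subsingleton ↥(⊥ : AddSubgroup (E [⋀^Fin l]→L[ℝ] ℂ)) :=
      ⟨fun x y ↦ Subtype.ext (((AddSubgroup.mem_bot).1 x.2).trans ((AddSubgroup.mem_bot).1 y.2).symm)⟩
    exact finrank_zero_of_subsingleton
  omega

omit [Fintype ι] [DecidableEq ι] in
/-- **`C(g, p)² < C(2g, 2p)` for `0 < p < g`**: by Vandermonde `C(2g, 2p) = ∑_{a+b=2p} C(g, a) C(g, b)` contains, besides the summand
`C(g, p)²` (`= h^{p,p}`), the positive summand `C(g, p−1) C(g, p+1)` (`= h^{p−1,p+1}`). [cite: Lange2023AbelianVarietiesComplex, §1.1.5 Prop. 1.1.23 and §1.1.3 Exercise 1.1.6 (8)] -/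
theorem choose_sq_lt_choose_two_mul {g q : ℕ} (hq : 0 < q) (hqg : q < g) : (g.choose q) ^ 2 < (2 * g).choose (2 * q) := by
  rw [two_mul g, Nat.add_choose_eq]
  have hsub : ({(q, q), (q - 1, q + 1)} : Finset (ℕ × ℕ)) ⊆ Finset.HasAntidiagonal.antidiagonal (2 * q) := by
    intro x hx
    simp only [Finset.mem_insert, Finset.mem_singleton] at hx
    rcases hx with rfl | rfl <;> simp <;> omega
  have hne : (q, q) ≠ (q - 1, q + 1) := fun h' ↦ by simpa using (Prod.ext_iff.1 h').2
  calc (g.choose q) ^ 2 < g.choose q * g.choose q + g.choose (q - 1) * g.choose (q + 1) := by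
        rw [sq]
        exact Nat.lt_add_of_pos_right (Nat.mul_pos (Nat.choose_pos (by omega)) (Nat.choose_pos (by omega)))
    _ = ∑ ij ∈ ({(q, q), (q - 1, q + 1)} : Finset (ℕ × ℕ)), g.choose ij.1 * g.choose ij.2 := by
        rw [Finset.sum_pair hne]
    _ ≤ ∑ ij ∈ Finset.HasAntidiagonal.antidiagonal (2 * q), g.choose ij.1 * g.choose ij.2 := Finset.sum_le_sum_of_subset hsub

/-- **The transcendental lattice is nonzero in every intermediate even degree**: for `0 < p < g = dim X` and `l = 2g − 2p`, `T ≠ 0` for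
EVERY complex torus `X` (the Hodge classes never fill `H^{2p}(X, ℚ)`, since `h^{p−1,p+1}(X) ≠ 0`).
[cite: Lange2023AbelianVarietiesComplex, §7.2.2 Thm. 7.2.4 and §1.1.5 Prop. 1.1.23] [cite: Huybrechts2016K3, Ch. 3 §2.2 (PDF p. 58)] -/
theorem integralHodgeAnnihilator_ne_bot {g : ℕ} (e₂ : Fin (2 * g) ≃ ι) (h₂ : 2 * p + l = 2 * g) (hp : 0 < p) (hpg : p < g) :
    integralForms Φ l ⊓ ⨅ s : integralHodgeClassesIn Φ (2 * p) p,
        (LinearMap.ker (poincarePairing Φ e₂ h₂ (s : E [⋀^Fin (2 * p)]→L[ℝ] ℂ))).toAddSubgroup ≠ ⊥ := by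
  haveI : FiniteDimensional ℝ E := LinearEquiv.finiteDimensional Φ.toLinearEquiv
  haveI : FiniteDimensional ℂ E := Module.Finite.of_restrictScalars_finite ℝ ℂ E
  have hg : Fintype.card ι = 2 * g := by rw [← Fintype.card_congr e₂, Fintype.card_fin]
  have hg' : finrank ℂ E = g := by have := card_eq_two_mul_finrank Φ; omega
  refine integralHodgeAnnihilator_ne_bot_of_choose_sq_lt Φ e₂ p h₂ ?_
  rw [hg', hg, show l = 2 * g - 2 * p by omega, Nat.choose_symm (by omega)]
  exact choose_sq_lt_choose_two_mul hp hpg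

/-! ## §5 Maximal Picard number: `rk T = C(2g, l) − C(g, p)²` -/

/-- **At maximal `p`-th Hodge number** (`dim_ℚ Bᵖ(X) = h^{p,p} = C(g, p)²`): `rk_ℤ T = C(|ι|, l) − C(g, p)²` in the complementary degree.
[cite: Lange2023AbelianVarietiesComplex, §7.2.2 Thm. 7.2.4 and §2.6.3 Exercise (2)] [cite: ShiodaMitani1974, §3 (3.19)] -/
theorem finrank_integralHodgeAnnihilator_of_finrank_hodgeClasses_eq (h₂ : 2 * p + l = n) {c : ℕ} (hB : finrank ℚ (hodgeClasses Φ p) = c) :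
    finrank ℤ ↥(integralForms Φ l ⊓ ⨅ s : integralHodgeClassesIn Φ (2 * p) p,
        (LinearMap.ker (poincarePairing Φ e h₂ (s : E [⋀^Fin (2 * p)]→L[ℝ] ℂ))).toAddSubgroup) = (Fintype.card ι).choose l - c := by
  rw [finrank_integralHodgeAnnihilator_eq, finrank_integralHodgeClassesIn_eq_finrank_hodgeClassesIn]
  exact congrArg _ hB

/-- **`rk T(E_τⁿ) = C(2n, l) − C(n, p)²`** in degree `l = 2n − 2p` for the CM power `E_τⁿ`, `τ` imaginary quadratic (`dim_ℚ Bᵖ(E_τⁿ) = C(n, p)²`,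
the tree's `finrank_hodgeClasses_ellipticPow_of_quadratic`). [cite: Lange2023AbelianVarietiesComplex, §2.6.3 Exercise (2) and §7.3.3 Exercise (3)] [cite: ShiodaMitani1974, §3 (3.19) and §4] -/
theorem finrank_integralHodgeAnnihilator_ellipticPow_of_quadratic {τ : ℂ} (hτ : τ.im ≠ 0) (m : ℕ) {a b : ℚ} (hq : τ ^ 2 + a * τ + b = 0)
    {n' : ℕ} (e' : Fin n' ≃ Fin m × Fin 2) (h₂ : 2 * p + l = n') :
    finrank ℤ ↥(integralForms (powPeriod (ellipticPeriod hτ) m) l ⊓ ⨅ s : integralHodgeClassesIn (powPeriod (ellipticPeriod hτ) m) (2 * p) p,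
        (LinearMap.ker (poincarePairing (powPeriod (ellipticPeriod hτ) m) e' h₂ (s : (Fin m → ℂ) [⋀^Fin (2 * p)]→L[ℝ] ℂ))).toAddSubgroup) =
      (2 * m).choose l - (m.choose p) ^ 2 := by
  rw [finrank_integralHodgeAnnihilator_of_finrank_hodgeClasses_eq (powPeriod (ellipticPeriod hτ) m) e' p h₂
    (finrank_hodgeClasses_ellipticPow_of_quadratic hτ m hq p), Fintype.card_prod, Fintype.card_fin, Fintype.card_fin, mul_comm]

/-- **`rk T(E_τ × E_τ) = 2` for a CM elliptic curve `E_τ`** (middle degree of the singular abelian surface `E_τ²`: `ρ = 4`, `rk T = 6 − 4 = 2`).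
[cite: ShiodaMitani1974, §3 (3.19) and §4] [cite: Lange2023AbelianVarietiesComplex, §2.6.3 Exercise (2)] -/
theorem finrank_integralHodgeAnnihilator_ellipticSq_of_quadratic {τ : ℂ} (hτ : τ.im ≠ 0) {a b : ℚ} (hq : τ ^ 2 + a * τ + b = 0)
    (e' : Fin 4 ≃ Fin 2 × Fin 2) (h₂ : 2 * 1 + 2 = 4) :
    finrank ℤ ↥(integralForms (powPeriod (ellipticPeriod hτ) 2) 2 ⊓ ⨅ s : integralHodgeClassesIn (powPeriod (ellipticPeriod hτ) 2) (2 * 1) 1,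
        (LinearMap.ker (poincarePairing (powPeriod (ellipticPeriod hτ) 2) e' h₂ (s : (Fin 2 → ℂ) [⋀^Fin (2 * 1)]→L[ℝ] ℂ))).toAddSubgroup) = 2 := by
  rw [finrank_integralHodgeAnnihilator_ellipticPow_of_quadratic 1 hτ 2 hq e' h₂]
  decide

end Transcendental

end Literature.Geometry.Kaehler.ComplexTorus
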